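import Summits.SmoothPoincare4.SmoothPoincare4.Theorems.ConvexBisectionAcyclicBisectionExistsPicardLefschetzChart
import Summits.SmoothPoincare4.SmoothPoincare4.Theorems.ConvexBisectionAcyclicBisectionExistsPageInvariance
import Literature.GroupTheory.CombinatorialGroupTheory.SignedHurwitzAction
import Literature.Topology.FourManifolds.KnotFraming
import HarnessLib

/-!
# Picard–Lefschetz on shadows, II: the crossing number and the correction chains of a page twist
(wave 2, brick N1a = (M3c) of stub `stub_modelsOnFibred_of_reach` = NF4
`Literature.Topology.FourManifolds.LefschetzBase.modelsOnFibred_of_reach`, line `modp-braid-orbits`,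
crux `ConvexBisection.AcyclicBisectionExists`, item stmt-SmoothPoincare4-10508; registered sub-goal
`helper_shadow_coreCircle`; file 2 of the Picard–Lefschetz bricks, sequel of
`…PicardLefschetzChart.lean`)

Set-up of node N1a (`NF4_Design.lean`): an annulus chart `φ : ℝ × ℝ → page g c` around the page
curve `a` (`φ (u, 0) = a (e^{2πiu})`), a profile `β` (`0` below `r = −1/2`, `1` above `r = 1/2`) and
the page twist `τ (φ (u, r)) = φ (u ± β r, r)`, `τ = id` off the open annulus
`A = φ(ℝ × (−1, 1))`.  This file defines the two book-keeping devices of the homological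
Picard–Lefschetz computation (file 3) and proves their pointwise properties:

* §1 `prelift`, `height` — a chosen preimage / transverse coordinate of a point of `A` (junk
  `(0, −1)` off `A`); `clampStep` (`χ`, the clamped linear step `0 → 1` across `[−1/2, 1/2]`),
  `phaseLoop φ K t = exp (2πi χ(height (K e^{2πit})))` and **`crossingNumber φ K := wind (phaseLoop φ K)`**
  — the signed number of crossings of the loop `K` with the framed page curve of the chart, from
  the side `r < 0` to the side `r > 0` (the degree of the transverse coordinate along the arcs of
  `K` inside the annulus);
* §2 `twistShift`, `corePath`, **`corrChain`** — the correction chain `κ_q` of a point `q`: the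
  singular `1`-simplex of the arc `t ↦ φ (u + t·(±β r), r)` from `q = φ (u, r)` to `τ q` (zero off
  `A`), with `∂ κ_q = [τ q] − [q]` on the page (`d_corrChain`);
* §3 off the closed collar `φ(ℝ × [−1/2, 1/2])`: `τ = id` (`tau_eq_self_of_not_mem_collar`), the
  phase is `1` (`phaseLoop_eq_one_of_not_mem_collar`), `κ_q` is a cycle whose homology shadow is
  `outerInd q · sgn s · shadow a` (**`shadowMap_corrChain`**; `helper_shadow_coreCircle`:
  `κ_q` is the core circle at height `r > 1/2` traversed `±` once — a loop freely homotopic in the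
  page to `a^{±1}`, `shadow_eq_of_loop_family`, `shadow_eq_neg_of_reverse` — or a constant path, or
  zero), and `outerInd q = χ (height q)` there (`outerInd_eq_clampStep`).

Everything is proved; no named facts, no `sorry`.  References: B. Farb, D. Margalit, *A primer on
mapping class groups* (2012), Prop. 6.3 [FarbMargalit2012]; A. Hatcher, *Algebraic Topology* (2002),
Thm. 2A.1 [HatcherAT2002].
-/

noncomputable section

set_option linter.dupNamespace false

open scoped Manifold ContDiff Topology Real
open Set Function Metric Filter
open Literature.Topology.FourManifolds Literature.Topology.FourManifolds.LefschetzBase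
  Literature.AlgebraicTopology.SingularHomology Literature.GroupTheory.CombinatorialGroupTheory.SignedHurwitz

namespace Summit.SmoothPoincare4.SmoothPoincare4.Theorems.AcyclicBisectionExists.ModpBraidOrbits

open SingularSimplex singularChainComplex

variable {g : ℕ} {c : ℂ} {φ : ℝ × ℝ → Base g}

/-! ## §1 The transverse coordinate and the crossing number -/

/-- A CHOSEN preimage in `ℝ × (−1, 1)` of a point of the open annulus of the chart `φ` (junk
`(0, −1)` off the annulus). [folklore] -/
def prelift (φ : ℝ × ℝ → Base g) (q : Base g) : ℝ × ℝ := by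
  classical
  exact if h : ∃ p : ℝ × ℝ, p.2 ∈ Ioo (-1 : ℝ) 1 ∧ φ p = q then h.choose else (0, -1)

/-- **The transverse coordinate** (height) of a point relative to the chart: the `r` of
`q = φ (u, r)` on the open annulus, `−1` off it. [folklore] -/
def height (φ : ℝ × ℝ → Base g) (q : Base g) : ℝ := (prelift φ q).2

/-- Membership in the open annulus, unfolded. [folklore] -/
theorem mem_annulus_iff {q : Base g} :
    q ∈ φ '' (univ ×ˢ Ioo (-1 : ℝ) 1) ↔ ∃ p : ℝ × ℝ, p.2 ∈ Ioo (-1 : ℝ) 1 ∧ φ p = q := by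
  constructor
  · rintro ⟨p, ⟨-, hp⟩, rfl⟩; exact ⟨p, hp, rfl⟩
  · rintro ⟨p, hp, rfl⟩; exact ⟨p, ⟨trivial, hp⟩, rfl⟩

/-- On the open annulus the chosen preimage is a preimage of admissible height. [folklore] -/
theorem prelift_spec {q : Base g} (hq : q ∈ φ '' (univ ×ˢ Ioo (-1 : ℝ) 1)) :
    (prelift φ q).2 ∈ Ioo (-1 : ℝ) 1 ∧ φ (prelift φ q) = q := by
  classical
  have h := mem_annulus_iff.1 hq
  rw [prelift, dif_pos h]
  exact h.choose_spec

/-- Off the open annulus the height is the junk value `−1`. [folklore] -/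
theorem height_of_not_mem {q : Base g} (hq : q ∉ φ '' (univ ×ˢ Ioo (-1 : ℝ) 1)) :
    height φ q = -1 := by
  classical
  have h : ¬ ∃ p : ℝ × ℝ, p.2 ∈ Ioo (-1 : ℝ) 1 ∧ φ p = q := fun h' => hq (mem_annulus_iff.2 h')
  rw [height, prelift, dif_neg h]

/-- **The height is the transverse coordinate**: `height (φ (u, r)) = r` and the chosen abscissa
is `u` up to an integer. [folklore] -/
theorem prelift_apply (hφ1 : ∀ u r, φ (u + 1, r) = φ (u, r))
    (hφi : InjOn φ (Ico (0 : ℝ) 1 ×ˢ Ioo (-1 : ℝ) 1)) {p : ℝ × ℝ} (hp : p.2 ∈ Ioo (-1 : ℝ) 1) :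
    (prelift φ (φ p)).2 = p.2 ∧ ∃ n : ℤ, (prelift φ (φ p)).1 = p.1 + n := by
  obtain ⟨h2, hφ⟩ := prelift_spec (φ := φ) ⟨p, ⟨trivial, hp⟩, rfl⟩
  obtain ⟨e2, n, hn⟩ := chart_eq_iff hφ1 hφi hp h2 hφ.symm
  exact ⟨e2.symm, n, hn⟩

/-- **The clamped step** `χ r = max 0 (min 1 (r + 1/2))`: `0` for `r ≤ −1/2`, `1` for
`r ≥ 1/2`, continuous. [folklore] -/
def clampStep (x : ℝ) : ℝ := max 0 (min 1 (x + 1 / 2))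

/-- `χ` is continuous. [folklore] -/
theorem continuous_clampStep : Continuous clampStep := by
  unfold clampStep; fun_prop

/-- `χ = 0` below `−1/2`. [folklore] -/
theorem clampStep_of_le {x : ℝ} (hx : x ≤ -(1 / 2 : ℝ)) : clampStep x = 0 := by
  unfold clampStep
  exact max_eq_left (min_le_of_right_le (by linarith))

/-- `χ = 1` above `1/2`. [folklore] -/
theorem clampStep_of_ge {x : ℝ} (hx : (1 / 2 : ℝ) ≤ x) : clampStep x = 1 := by
  unfold clampStep
  rw [min_eq_left (by linarith), max_eq_right zero_le_one]

/-- **The phase loop** of a circle map `K` relative to the chart: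
`t ↦ exp (2πi χ(height (K (e^{2πit}))))` — a unit complex number, equal to `1` whenever
`K (e^{2πit})` is off the collar `φ(ℝ × (−1/2, 1/2))`. [folklore] -/
def phaseLoop (φ : ℝ × ℝ → Base g) (K : sphere (0 : EuclideanSpace ℝ (Fin 2)) 1 → Base g)
    (t : ℝ) : ℂ :=
  Complex.exp (((2 * π * clampStep (height φ (K (circlePt t))) : ℝ) : ℂ) * Complex.I)

/-- **The crossing number** of the loop `K` with the framed page curve presented by the annulus
chart `φ`: the winding number of the phase loop, i.e. the degree of the transverse coordinate
`χ ∘ r ∘ φ⁻¹ (mod 1)` along `K` — the signed count of passages of `K` through the annulus from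
the side `r < 0` to the side `r > 0`.  (For a chart positively oriented by the complex orientation
of the page this is the algebraic intersection number `a · K`.) [cite: FarbMargalit2012, §6.1] -/
def crossingNumber (φ : ℝ × ℝ → Base g) (K : sphere (0 : EuclideanSpace ℝ (Fin 2)) 1 → Base g) :
    ℤ :=
  Literature.Topology.PlaneTopology.wind (phaseLoop φ K)

/-! ## §2 The shear profile, core paths and correction chains -/

/-- The signed shear profile: `β` for `s = true`, `−β` for `s = false`. [folklore] -/
def twistShift (s : Bool) (β : ℝ → ℝ) (r : ℝ) : ℝ := if s then β r else -β r

/-- **The core path of a point of the chart domain**: `t ↦ φ (u + t · twistShift s β r, r)`, from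
`φ (u, r)` to the image of `φ (u, r)` under the shear. [folklore] -/
def corePath (hφc : Continuous φ) (s : Bool) (β : ℝ → ℝ) (p : ℝ × ℝ) :
    Path (φ p) (φ (p.1 + twistShift s β p.2, p.2)) where
  toFun t := φ (p.1 + (t : ℝ) * twistShift s β p.2, p.2)
  continuous_toFun := hφc.comp (by fun_prop)
  source' := by simp
  target' := by simp

/-- **The correction chain `κ_q`**: the singular `1`-simplex of the core path of the chosen
preimage of `q` (from `q` to `τ q`) if `q` lies in the open annulus, `0` otherwise. [folklore] -/
def corrChain (hφc : Continuous φ) (s : Bool) (β : ℝ → ℝ) (q : Base g) :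
    (singularChainComplex ℤ ℤ (Base g)).X 1 := by
  classical
  exact if q ∈ φ '' (univ ×ˢ Ioo (-1 : ℝ) 1) then
    single (R := ℤ) (ofPath (corePath hφc s β (prelift φ q))) 1 else 0

/-- Two paths with the same underlying map have the same singular `1`-simplex. [folklore] -/
theorem ofPath_congr {X : Type*} [TopologicalSpace X] {x y x' y' : X} (γ : Path x y)
    (γ' : Path x' y') (h : ∀ t, γ t = γ' t) : ofPath γ = ofPath γ' := by
  apply toContinuousMap_injective
  ext t : 1
  rw [ofPath_apply, ofPath_apply, h]

variable {τ : Base g → Base g} {s : Bool} {β : ℝ → ℝ}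
  {a : sphere (0 : EuclideanSpace ℝ (Fin 2)) 1 → Base g}

/-- **`∂ κ_q = [τ q] − [q]`** for every point `q` of the page. [folklore] -/
theorem d_corrChain (hφc : Continuous φ)
    (hτon : ∀ u r, r ∈ Ioo (-1 : ℝ) 1 → τ (φ (u, r)) = φ (u + (if s then β r else -β r), r))
    (hτoff : ∀ p ∈ page g c, p ∉ φ '' (univ ×ˢ Ioo (-1 : ℝ) 1) → τ p = p)
    {q : Base g} (hq : q ∈ page g c) :
    (singularChainComplex ℤ ℤ (Base g)).d 1 0 (corrChain hφc s β q) =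
      single (R := ℤ) (ofPoint (τ q)) 1 - single (R := ℤ) (ofPoint q) 1 := by
  classical
  by_cases hA : q ∈ φ '' (univ ×ˢ Ioo (-1 : ℝ) 1)
  · rw [corrChain, if_pos hA, d_single_ofPath]
    obtain ⟨h2, hq'⟩ := prelift_spec hA
    have e1 : φ ((prelift φ q).1 + twistShift s β (prelift φ q).2, (prelift φ q).2) = τ q := by
      have h := hτon (prelift φ q).1 (prelift φ q).2 h2
      rw [Prod.mk.eta, hq'] at h
      rw [twistShift]
      exact h.symm
    rw [e1, hq']
  · rw [corrChain, if_neg hA, map_zero, hτoff q hq hA, sub_self]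

/-! ## §3 Off the collar: `τ = id`, the phase is `1`, the classes of the correction chains -/

/-- **Off the closed collar the twist is the identity** (there `β ∈ {0, 1}` or `τ = id`).
[folklore] -/
theorem tau_eq_self_of_not_mem_collar (hφ1 : ∀ u r, φ (u + 1, r) = φ (u, r))
    (hβ0 : ∀ r ≤ -(1 / 2 : ℝ), β r = 0) (hβ1 : ∀ r ≥ (1 / 2 : ℝ), β r = 1)
    (hτon : ∀ u r, r ∈ Ioo (-1 : ℝ) 1 → τ (φ (u, r)) = φ (u + (if s then β r else -β r), r))
    (hτoff : ∀ p ∈ page g c, p ∉ φ '' (univ ×ˢ Ioo (-1 : ℝ) 1) → τ p = p)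
    {q : Base g} (hq : q ∈ page g c) (hqB : q ∉ φ '' (univ ×ˢ Icc (-(1 / 2) : ℝ) (1 / 2))) :
    τ q = q := by
  by_cases hA : q ∈ φ '' (univ ×ˢ Ioo (-1 : ℝ) 1)
  · obtain ⟨p, ⟨-, hp⟩, rfl⟩ := hA
    have hr : p.2 < -(1 / 2) ∨ 1 / 2 < p.2 := by
      by_contra h
      push Not at h
      exact hqB ⟨p, ⟨trivial, h.1, h.2⟩, rfl⟩
    have h := hτon p.1 p.2 hp
    rw [Prod.mk.eta] at h
    rw [h]
    rcases hr with hr | hr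
    · rw [hβ0 _ hr.le]; simp
    · rw [hβ1 _ hr.le]
      cases s
      · have := chart_periodic_int hφ1 (-1) p.1 p.2
        push_cast at this
        simpa using this
      · simpa using hφ1 p.1 p.2
  · exact hτoff q hq hA

/-- Off the collar the height avoids `[−1/2, 1/2]`: above `1/2` on the annulus, below `−1/2` on
the annulus, or off the annulus (junk height `−1`). [folklore] -/
theorem height_cases_of_not_mem_collar {q : Base g}
    (hqB : q ∉ φ '' (univ ×ˢ Icc (-(1 / 2) : ℝ) (1 / 2))) :
    (q ∈ φ '' (univ ×ˢ Ioo (-1 : ℝ) 1) ∧ 1 / 2 < height φ q) ∨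
      (q ∈ φ '' (univ ×ˢ Ioo (-1 : ℝ) 1) ∧ height φ q < -(1 / 2)) ∨
      q ∉ φ '' (univ ×ˢ Ioo (-1 : ℝ) 1) := by
  by_cases hA : q ∈ φ '' (univ ×ˢ Ioo (-1 : ℝ) 1)
  · obtain ⟨-, hq'⟩ := prelift_spec hA
    have hr : (prelift φ q).2 < -(1 / 2) ∨ 1 / 2 < (prelift φ q).2 := by
      by_contra h
      push Not at h
      exact hqB ⟨prelift φ q, ⟨trivial, h.1, h.2⟩, hq'⟩
    rcases hr with hr | hr
    · exact Or.inr (Or.inl ⟨hA, hr⟩)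
    · exact Or.inl ⟨hA, hr⟩
  · exact Or.inr (Or.inr hA)

/-- **The outer indicator** of a point: `1` if it lies in the open annulus at height `≥ 1/2`,
`0` otherwise. [folklore] -/
def outerInd (φ : ℝ × ℝ → Base g) (q : Base g) : ℤ := by
  classical
  exact if q ∈ φ '' (univ ×ˢ Ioo (-1 : ℝ) 1) ∧ 1 / 2 ≤ height φ q then 1 else 0

/-- **Off the collar the outer indicator is the clamped height** `χ (height q)`. [folklore] -/
theorem outerInd_eq_clampStep {q : Base g} (hqB : q ∉ φ '' (univ ×ˢ Icc (-(1 / 2) : ℝ) (1 / 2))) :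
    (outerInd φ q : ℝ) = clampStep (height φ q) := by
  classical
  rcases height_cases_of_not_mem_collar hqB with ⟨hA, hr⟩ | ⟨hA, hr⟩ | hA
  · rw [outerInd, if_pos ⟨hA, hr.le⟩, clampStep_of_ge hr.le]; simp
  · rw [outerInd, if_neg (fun h => by linarith [h.2]), clampStep_of_le hr.le]; simp
  · rw [outerInd, if_neg (fun h => hA h.1), height_of_not_mem hA, clampStep_of_le (by norm_num)]
    simp

/-- **Off the collar the phase is `1`.** [folklore] -/
theorem phaseLoop_eq_one_of_not_mem_collar {K : sphere (0 : EuclideanSpace ℝ (Fin 2)) 1 → Base g}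
    {t : ℝ} (hqB : K (circlePt t) ∉ φ '' (univ ×ˢ Icc (-(1 / 2) : ℝ) (1 / 2))) :
    phaseLoop φ K t = 1 := by
  rw [phaseLoop, ← outerInd_eq_clampStep hqB]
  classical
  by_cases h : K (circlePt t) ∈ φ '' (univ ×ˢ Ioo (-1 : ℝ) 1) ∧ 1 / 2 ≤ height φ (K (circlePt t))
  · rw [outerInd, if_pos h]
    simp
  · rw [outerInd, if_neg h]
    simp

/-- **The core circles of the chart**: for `σ = ±1` there is a continuous circle map `C` with
`C (e^{2πit}) = φ (u + σ t, r)` for all real `t`. [folklore] -/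
theorem exists_coreCircle (hφc : Continuous φ) (hφ1 : ∀ u r, φ (u + 1, r) = φ (u, r))
    (u r σ : ℝ) (hσ : σ = 1 ∨ σ = -1) :
    ∃ C : sphere (0 : EuclideanSpace ℝ (Fin 2)) 1 → Base g, Continuous C ∧
      ∀ t : ℝ, C (circlePt t) = φ (u + σ * t, r) := by
  have hint : ∀ (t : ℝ) (m : ℤ), φ (u + σ * (t + m), r) = φ (u + σ * t, r) := by
    intro t m
    rcases hσ with rfl | rfl
    · rw [show u + 1 * (t + m) = u + 1 * t + (m : ℤ) by ring, chart_periodic_int hφ1]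
    · rw [show u + -1 * (t + m) = u + -1 * t + ((-m : ℤ) : ℝ) by push_cast; ring,
        chart_periodic_int hφ1]
  let γ : C(unitInterval, Base g) := ⟨fun t => φ (u + σ * t, r), hφc.comp (by fun_prop)⟩
  have h01 : γ 0 = γ 1 := by
    show φ (u + σ * (0 : unitInterval), r) = φ (u + σ * (1 : unitInterval), r)
    have := hint 0 1
    simp only [Int.cast_one, zero_add] at this
    rw [Set.Icc.coe_zero, Set.Icc.coe_one, this]
  refine ⟨loopCircleMap γ h01, (loopCircleMap γ h01).continuous, fun t => ?_⟩
  have ht : Int.fract t ∈ Icc (0 : ℝ) 1 := ⟨Int.fract_nonneg t, (Int.fract_lt_one t).le⟩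
  have e1 : circlePt t = circleParam ⟨Int.fract t, ht⟩ := by
    show circlePt t = circlePt (Int.fract t)
    rw [← circlePt_add_int (Int.fract t) ⌊t⌋, Int.fract_add_floor]
  rw [e1, loopCircleMap_circleParam]
  show φ (u + σ * Int.fract t, r) = φ (u + σ * t, r)
  rw [← hint t (-⌊t⌋), Int.fract, Int.cast_neg, sub_eq_add_neg]

/-- **A core circle traversed positively has the shadow of `a`** (free homotopy
`λ ↦ φ (λu + t, λr)` through the chart down to `a = φ (·, 0)`). [cite: HatcherAT2002, Thm. 2A.1] -/
theorem shadow_coreCircle_pos (hφc : Continuous φ) (hφ1 : ∀ u r, φ (u + 1, r) = φ (u, r))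
    (hφa : ∀ u, φ (u, 0) = a (circlePt u)) (ha : Continuous a)
    {C : sphere (0 : EuclideanSpace ℝ (Fin 2)) 1 → Base g} (hC : Continuous C) {u r : ℝ}
    (hCt : ∀ t : ℝ, C (circlePt t) = φ (u + 1 * t, r)) : shadow g C hC = shadow g a ha := by
  refine (shadow_eq_of_loop_family ha hC (fun l t => φ (l * u + t, l * r)) ?_ ?_ ?_ ?_).symm
  · exact (hφc.comp (by fun_prop)).continuousOn
  · intro l _
    show φ (l * u + 0, l * r) = φ (l * u + 1, l * r)
    rw [hφ1, add_zero]
  · intro t _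
    show φ (0 * u + t, 0 * r) = a (circlePt t)
    rw [zero_mul, zero_mul, zero_add, hφa]
  · intro t _
    show φ (1 * u + t, 1 * r) = C (circlePt t)
    rw [hCt]; ring_nf

/-- **A core circle traversed negatively has the opposite shadow.** [cite: HatcherAT2002, Thm. 2A.1] -/
theorem shadow_coreCircle_neg (hφc : Continuous φ) (hφ1 : ∀ u r, φ (u + 1, r) = φ (u, r))
    (hφa : ∀ u, φ (u, 0) = a (circlePt u)) (ha : Continuous a)
    {C : sphere (0 : EuclideanSpace ℝ (Fin 2)) 1 → Base g} (hC : Continuous C) {u r : ℝ}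
    (hCt : ∀ t : ℝ, C (circlePt t) = φ (u + -1 * t, r)) : shadow g C hC = -shadow g a ha := by
  obtain ⟨C', hC', hC't⟩ := exists_coreCircle hφc hφ1 u r 1 (Or.inl rfl)
  rw [← shadow_coreCircle_pos hφc hφ1 hφa ha hC' hC't]
  refine shadow_eq_neg_of_reverse hC' hC fun t => ?_
  rw [hCt, hC't]; ring_nf

/-- Off the collar the correction chain is a cycle. [folklore] -/
theorem corrChain_cycle (hφc : Continuous φ) (hφ1 : ∀ u r, φ (u + 1, r) = φ (u, r))
    (hβ0 : ∀ r ≤ -(1 / 2 : ℝ), β r = 0) (hβ1 : ∀ r ≥ (1 / 2 : ℝ), β r = 1)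
    (hτon : ∀ u r, r ∈ Ioo (-1 : ℝ) 1 → τ (φ (u, r)) = φ (u + (if s then β r else -β r), r))
    (hτoff : ∀ p ∈ page g c, p ∉ φ '' (univ ×ˢ Ioo (-1 : ℝ) 1) → τ p = p)
    {q : Base g} (hq : q ∈ page g c) (hqB : q ∉ φ '' (univ ×ˢ Icc (-(1 / 2) : ℝ) (1 / 2))) :
    (singularChainComplex ℤ ℤ (Base g)).d 1 ((ComplexShape.down ℕ).next 1)
      (corrChain hφc s β q) = 0 := by
  rw [d_next_eq_zero_iff (ChainComplex.next_nat_succ 0), d_corrChain hφc hτon hτoff hq,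
    tau_eq_self_of_not_mem_collar hφ1 hβ0 hβ1 hτon hτoff hq hqB, sub_self]

/-- **The homology shadow of a correction chain off the collar**:
`shadowMap [κ_q] = outerInd q · sgn s · shadow a` — the core circle at height `r > 1/2` run `±`
once, a constant path at height `r < −1/2`, or zero off the annulus.
[cite: FarbMargalit2012, Prop. 6.3] -/
theorem shadowMap_corrChain (hφc : Continuous φ) (hφ1 : ∀ u r, φ (u + 1, r) = φ (u, r))
    (hφa : ∀ u, φ (u, 0) = a (circlePt u)) (ha : Continuous a)
    (hβ0 : ∀ r ≤ -(1 / 2 : ℝ), β r = 0) (hβ1 : ∀ r ≥ (1 / 2 : ℝ), β r = 1)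
    {q : Base g} (hqB : q ∉ φ '' (univ ×ˢ Icc (-(1 / 2) : ℝ) (1 / 2)))
    (hz : (singularChainComplex ℤ ℤ (Base g)).d 1 ((ComplexShape.down ℕ).next 1)
      (corrChain hφc s β q) = 0) :
    shadowMap g (homologyCls (corrChain hφc s β q) hz) =
      (outerInd φ q * (sgn s : ℤ)) • shadow g a ha := by
  classical
  rcases height_cases_of_not_mem_collar hqB with ⟨hA, hr⟩ | ⟨hA, hr⟩ | hA
  · -- the core circle at height `> 1/2`, run `±` once
    obtain ⟨h2, hq'⟩ := prelift_spec hA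
    set p := prelift φ q with hp
    have hβ : β p.2 = 1 := hβ1 _ hr.le
    set σ : ℝ := if s then 1 else -1 with hσ
    have hσ' : σ = 1 ∨ σ = -1 := by cases s <;> simp [hσ]
    obtain ⟨C, hC, hCt⟩ := exists_coreCircle hφc hφ1 p.1 p.2 σ hσ'
    have hcls : homologyCls (corrChain hφc s β q) hz = loopClass ℤ ℤ (1 : ℤ) (loopPath C hC) := by
      rw [loopClass]
      apply homologyCls_congr
      rw [corrChain, if_pos hA, ← hp]
      congr 1
      refine ofPath_congr _ _ fun t => ?_
      show φ (p.1 + (t : ℝ) * twistShift s β p.2, p.2) = C (circlePt t)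
      rw [hCt, twistShift, hβ]
      congr 2
      cases s <;> simp [hσ]
    rw [hcls, outerInd, if_pos ⟨hA, hr.le⟩, one_mul]
    show shadow g C hC = _
    cases s
    · rw [sgn_false, neg_one_zsmul]
      exact shadow_coreCircle_neg hφc hφ1 hφa ha hC (by simpa [hσ] using hCt)
    · rw [sgn_true, one_zsmul]
      exact shadow_coreCircle_pos hφc hφ1 hφa ha hC (by simpa [hσ] using hCt)
  · -- a constant path at height `< -1/2`
    obtain ⟨h2, hq'⟩ := prelift_spec hA
    have hβ : β (prelift φ q).2 = 0 := hβ0 _ hr.le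
    have h0 : homologyCls (corrChain hφc s β q) hz = 0 := by
      rw [homologyCls_eq_zero_iff, exists_d_prev_eq_iff (i := 2) (ChainComplex.prev ℕ 1)]
      refine ⟨single (R := ℤ) (const₂ q) 1, ?_⟩
      rw [d_single_const₂, corrChain, if_pos hA]
      congr 1
      refine ofPath_congr _ _ fun t => ?_
      show q = φ ((prelift φ q).1 + (t : ℝ) * twistShift s β (prelift φ q).2, (prelift φ q).2)
      rw [twistShift, hβ]
      simp [hq']
    rw [h0, map_zero, outerInd, if_neg (fun h => by linarith [h.2]), zero_mul, zero_smul]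
  · -- zero off the annulus
    have h0 : homologyCls (corrChain hφc s β q) hz = 0 := by
      have e : corrChain hφc s β q = 0 := by rw [corrChain, if_neg hA]
      rw [homologyCls_congr e hz (by rw [map_zero]), homologyCls_zero]
    rw [h0, map_zero, outerInd, if_neg (fun h => hA h.1), zero_mul, zero_smul]

/-- **Sub-goal `helper_shadow_coreCircle`** (N1a of NF4, file 2): a circle map of the base which
is a core circle `t ↦ φ (u + t, r)` of an annulus chart `φ` around the page curve `a`
(`φ (u, 0) = a (e^{2πiu})`, `φ` `1`-periodic in `u`) has the homology shadow of `a`, in registered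
form. [cite: HatcherAT2002, Thm. 2A.1] -/
theorem helper_shadow_coreCircle : ∀ (g : ℕ) (φ : ℝ × ℝ → Literature.Topology.FourManifolds.LefschetzBase.Base g) (a C : Metric.sphere (0 : EuclideanSpace ℝ (Fin 2)) 1 → Literature.Topology.FourManifolds.LefschetzBase.Base g) (ha : Continuous a) (hC : Continuous C) (u r : ℝ), Continuous φ → (∀ u r, φ (u + 1, r) = φ (u, r)) → (∀ u, φ (u, 0) = a (Literature.Topology.FourManifolds.circlePt u)) → (∀ t : ℝ, C (Literature.Topology.FourManifolds.circlePt t) = φ (u + 1 * t, r)) → Literature.Topology.FourManifolds.LefschetzBase.shadow g C hC = Literature.Topology.FourManifolds.LefschetzBase.shadow g a ha :=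
  fun _ _ _ _ ha hC _ _ hφc hφ1 hφa hCt => shadow_coreCircle_pos hφc hφ1 hφa ha hC hCt

end Summit.SmoothPoincare4.SmoothPoincare4.Theorems.AcyclicBisectionExists.ModpBraidOrbits

end
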